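import Summits.CriticalPhenomena.PercolationContinuityZ3.Theorems.Transplant.FKConnectivityAllQPat3MinorDefs
import Summits.CriticalPhenomena.PercolationContinuityZ3.Theorems.Transplant.FKConnectivityAllQPat3SymCone
import HarnessLib

/-!
# Connectivity correlation inequalities for `φ_{w,q}`, every `q > 0` — the SYMMETRISED PRODUCT-CONE LEMMA on MINORS

Definitions + theorems file (`--supports stmt-CriticalPhenomena-4575`), census lineage (gen 37) of LANE 2's FK sub-programme; builds on
p205010 (kernel theorem, internal audit signed; external expert review pending).  No named facts, no sorries; standard axioms.

The `(E, C)`-versions (contracted sets riding along, fk-2's `FK.apExpC`; census g36's `FK.lev2C`/`FK.tvalC`, census g37's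
`FK.mval2C`) of census g36's levelwise regrouping and product-cone machinery (`…Pat3Levels.lean`, `…Pat3Cone.lean`,
`…Pat3SymCone.lean`): `FK.lev2C_eq_sum`, `FK.mval2C_eq_tvalC_add`, `FK.regroup1C`, `FK.lev2C_decomp3`, `FK.sum_powerset_flip3C`,
`FK.tripleSumC` (+ flips / linearity / `symm8`), `FK.tripleSumC_bterm_nonneg`, and **`FK.cone3C_level_nonneg_sym`**: a three-piece
gluing law `hdec` for the MINORS `(E_p, C_p)` of the pieces and the composite minor `(G, CG)`, a symmetrised product-cone certificate
(the SAME table inequality as for `C = ∅`), and levelwise validity of the generators on the pieces' minors give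
`0 ≤ D · lev2C G CG b s t T λ` at every level.  The proofs are census g36's with `γ ∪ C` for `γ` and `apExpC` for `apExp`.
Used by `…Pat3MinorGraphCone.lean` (THETA/RING/CORNER/cut certificates on minors) towards THEOREM SP on every minor of a
two-terminal series–parallel network (⇒ `δ_w ≥ 0` for arbitrary weights, `FK.two_mul_deltaMass_eq_sum_antipodal`).
[cite: AyyerLinussonRavichandran2025, §7 eq. (13)–(15) (p. 22)] [cite: Grimmett2006, §3.8 (pp. 61–62)]
-/

noncomputable section

namespace Summit.CriticalPhenomena.PercolationContinuityZ3.Theorems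

namespace FK

open SimpleGraph Literature.Probability.LatticeModels Literature.Probability.Percolation

section MinorLevels

open scoped Classical

variable {V : Type*}

/-- `lev2` with the two levels written as a sum over `c < 2`. [folklore] -/
theorem lev2C_eq_sum (E C : Finset (Sym2 V)) (x y s : V) (F : ℕ → Pat3 → Pat3 → ℤ) (μ : ℕ) :
    lev2C E C x y s F μ = ∑ γ ∈ E.powerset, ∑ c ∈ Finset.range 2,
      (if apExpC E C γ + c = μ then F c (pat3 (γ ∪ C) x y s) (pat3 (E \ γ ∪ C) x y s) else 0) := by
  unfold lev2C
  refine Finset.sum_congr rfl fun γ _ => ?_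
  rw [Finset.sum_range_succ, Finset.sum_range_succ, Finset.sum_range_zero, zero_add, add_zero]

/-- `mval2` as two one-level evaluations. [folklore] -/
theorem mval2C_eq_tvalC_add (w : ℕ → ℝ) (E C : Finset (Sym2 V)) (x y s : V) (F : ℕ → Pat3 → Pat3 → ℤ) :
    mval2C w E C x y s F = tvalC w E C x y s (F 0) + tvalC (fun n => w (n + 1)) E C x y s (F 1) := by
  unfold mval2C tvalC
  rw [← Finset.sum_add_distrib]

/-- **Single-piece regrouping**: summing a generator's contributions over the configurations of one piece, against a level
constraint, gives its levelwise values. [folklore] -/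
theorem regroup1C (E C : Finset (Sym2 V)) (x y s : V) (g : ℕ → Pat3 → Pat3 → ℤ) (N r : ℕ) (z : ℤ) :
    (∑ γ ∈ E.powerset, ∑ k ∈ Finset.range 2,
      (if apExpC E C γ + k + r = N then g k (pat3 (γ ∪ C) x y s) (pat3 (E \ γ ∪ C) x y s) * z else 0)) =
      ∑ μ ∈ Finset.range (N + 1), (if μ + r = N then lev2C E C x y s g μ * z else 0) := by
  have rhs : ∀ μ ∈ Finset.range (N + 1), (if μ + r = N then lev2C E C x y s g μ * z else 0) =
      ∑ γ ∈ E.powerset, ∑ k ∈ Finset.range 2,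
        (if μ + r = N then (if apExpC E C γ + k = μ then g k (pat3 (γ ∪ C) x y s) (pat3 (E \ γ ∪ C) x y s) else 0) * z else 0) := by
    intro μ _
    rw [lev2C_eq_sum, Finset.sum_mul, ite_sum_zero]
    refine Finset.sum_congr rfl fun γ _ => ?_
    rw [Finset.sum_mul, ite_sum_zero]
  rw [Finset.sum_congr rfl rhs]
  symm
  conv_lhs => rw [Finset.sum_comm]
  refine Finset.sum_congr rfl fun γ _ => ?_
  conv_lhs => rw [Finset.sum_comm]
  refine Finset.sum_congr rfl fun k _ => ?_
  rw [Finset.sum_eq_single (apExpC E C γ + k)]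
  · by_cases h : apExpC E C γ + k + r = N
    · rw [if_pos h, if_pos rfl, if_pos h]
    · rw [if_neg h, if_neg h]
  · intro μ _ hne
    rw [if_neg (Ne.symm hne), zero_mul, ite_self]
  · intro hmem
    rw [Finset.mem_range, not_lt] at hmem
    have : ¬ (apExpC E C γ + k + r = N) := by omega
    rw [if_neg this]

end MinorLevels

section MinorCone

open scoped Classical

variable {V : Type*}

/-- **Levelwise trilinear decomposition** of a two-level member over a three-piece gluing (integer form of
`FK.tval_union3_theta` / `FK.tval_union3_ring`). [folklore] -/
theorem lev2C_decomp3 {EK CK E₁ C₁ E₂ C₂ G CG : Finset (Sym2 V)} {b s t uK vK mK u₁ v₁ m₁ u₂ v₂ m₂ : V}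
    (join : Pat3 → Pat3 → Pat3 → Pat3) (corr : Pat3 → Pat3 → Pat3 → ℕ) (S : ℕ)
    (hdec : ∀ (w : ℕ → ℝ) (tab : Pat3 → Pat3 → ℤ),
      tvalC (fun n => w (n + S)) G CG b s t tab =
        ∑ γK ∈ EK.powerset, ∑ γ₁ ∈ E₁.powerset, ∑ γ₂ ∈ E₂.powerset,
          w (apExpC EK CK γK + apExpC E₁ C₁ γ₁ + apExpC E₂ C₂ γ₂ +
                corr (pat3 (γK ∪ CK) uK vK mK) (pat3 (γ₁ ∪ C₁) u₁ v₁ m₁) (pat3 (γ₂ ∪ C₂) u₂ v₂ m₂) +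
              corr (pat3 (EK \ γK ∪ CK) uK vK mK) (pat3 (E₁ \ γ₁ ∪ C₁) u₁ v₁ m₁) (pat3 (E₂ \ γ₂ ∪ C₂) u₂ v₂ m₂)) *
            (tab (join (pat3 (γK ∪ CK) uK vK mK) (pat3 (γ₁ ∪ C₁) u₁ v₁ m₁) (pat3 (γ₂ ∪ C₂) u₂ v₂ m₂))
              (join (pat3 (EK \ γK ∪ CK) uK vK mK) (pat3 (E₁ \ γ₁ ∪ C₁) u₁ v₁ m₁) (pat3 (E₂ \ γ₂ ∪ C₂) u₂ v₂ m₂)) : ℝ))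
    (T : ℕ → Pat3 → Pat3 → ℤ) (lam0 : ℕ) :
    lev2C G CG b s t T lam0 = ∑ γK ∈ EK.powerset, ∑ γ₁ ∈ E₁.powerset, ∑ γ₂ ∈ E₂.powerset,
      ((if apExpC EK CK γK + apExpC E₁ C₁ γ₁ + apExpC E₂ C₂ γ₂ +
            corr (pat3 (γK ∪ CK) uK vK mK) (pat3 (γ₁ ∪ C₁) u₁ v₁ m₁) (pat3 (γ₂ ∪ C₂) u₂ v₂ m₂) +
            corr (pat3 (EK \ γK ∪ CK) uK vK mK) (pat3 (E₁ \ γ₁ ∪ C₁) u₁ v₁ m₁) (pat3 (E₂ \ γ₂ ∪ C₂) u₂ v₂ m₂) = lam0 + S then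
          T 0 (join (pat3 (γK ∪ CK) uK vK mK) (pat3 (γ₁ ∪ C₁) u₁ v₁ m₁) (pat3 (γ₂ ∪ C₂) u₂ v₂ m₂))
            (join (pat3 (EK \ γK ∪ CK) uK vK mK) (pat3 (E₁ \ γ₁ ∪ C₁) u₁ v₁ m₁) (pat3 (E₂ \ γ₂ ∪ C₂) u₂ v₂ m₂)) else 0) +
        (if apExpC EK CK γK + apExpC E₁ C₁ γ₁ + apExpC E₂ C₂ γ₂ +
            corr (pat3 (γK ∪ CK) uK vK mK) (pat3 (γ₁ ∪ C₁) u₁ v₁ m₁) (pat3 (γ₂ ∪ C₂) u₂ v₂ m₂) +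
            corr (pat3 (EK \ γK ∪ CK) uK vK mK) (pat3 (E₁ \ γ₁ ∪ C₁) u₁ v₁ m₁) (pat3 (E₂ \ γ₂ ∪ C₂) u₂ v₂ m₂) + 1 = lam0 + S then
          T 1 (join (pat3 (γK ∪ CK) uK vK mK) (pat3 (γ₁ ∪ C₁) u₁ v₁ m₁) (pat3 (γ₂ ∪ C₂) u₂ v₂ m₂))
            (join (pat3 (EK \ γK ∪ CK) uK vK mK) (pat3 (E₁ \ γ₁ ∪ C₁) u₁ v₁ m₁) (pat3 (E₂ \ γ₂ ∪ C₂) u₂ v₂ m₂)) else 0)) := by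
  have hw0 : (fun n : ℕ => if n = lam0 then (1 : ℝ) else 0) =
      fun n => (fun m : ℕ => if m = lam0 + S then (1 : ℝ) else 0) (n + S) := by
    funext n
    have e : (n = lam0) ↔ (n + S = lam0 + S) := by constructor <;> intro h <;> omega
    simp only [e]
  have h1 := hdec (fun m : ℕ => if m = lam0 + S then (1 : ℝ) else 0) (T 0)
  have h2 := hdec (fun m : ℕ => if m + 1 = lam0 + S then (1 : ℝ) else 0) (T 1)
  have key : (lev2C G CG b s t T lam0 : ℝ) = _ := lev2C_cast G CG b s t T lam0
  rw [mval2C_eq_tvalC_add, hw0, h1] at key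
  have hw1 : (fun n : ℕ => if n + 1 = lam0 then (1 : ℝ) else 0) =
      fun n => (fun m : ℕ => if m + 1 = lam0 + S then (1 : ℝ) else 0) (n + S) := by
    funext n
    have e : (n + 1 = lam0) ↔ (n + S + 1 = lam0 + S) := by constructor <;> intro h <;> omega
    simp only [e]
  rw [hw1, h2, ← Finset.sum_add_distrib] at key
  have : ((lev2C G CG b s t T lam0 : ℤ) : ℝ) = ((∑ γK ∈ EK.powerset, ∑ γ₁ ∈ E₁.powerset, ∑ γ₂ ∈ E₂.powerset,
      ((if apExpC EK CK γK + apExpC E₁ C₁ γ₁ + apExpC E₂ C₂ γ₂ +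
            corr (pat3 (γK ∪ CK) uK vK mK) (pat3 (γ₁ ∪ C₁) u₁ v₁ m₁) (pat3 (γ₂ ∪ C₂) u₂ v₂ m₂) +
            corr (pat3 (EK \ γK ∪ CK) uK vK mK) (pat3 (E₁ \ γ₁ ∪ C₁) u₁ v₁ m₁) (pat3 (E₂ \ γ₂ ∪ C₂) u₂ v₂ m₂) = lam0 + S then
          T 0 (join (pat3 (γK ∪ CK) uK vK mK) (pat3 (γ₁ ∪ C₁) u₁ v₁ m₁) (pat3 (γ₂ ∪ C₂) u₂ v₂ m₂))
            (join (pat3 (EK \ γK ∪ CK) uK vK mK) (pat3 (E₁ \ γ₁ ∪ C₁) u₁ v₁ m₁) (pat3 (E₂ \ γ₂ ∪ C₂) u₂ v₂ m₂)) else 0) +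
        (if apExpC EK CK γK + apExpC E₁ C₁ γ₁ + apExpC E₂ C₂ γ₂ +
            corr (pat3 (γK ∪ CK) uK vK mK) (pat3 (γ₁ ∪ C₁) u₁ v₁ m₁) (pat3 (γ₂ ∪ C₂) u₂ v₂ m₂) +
            corr (pat3 (EK \ γK ∪ CK) uK vK mK) (pat3 (E₁ \ γ₁ ∪ C₁) u₁ v₁ m₁) (pat3 (E₂ \ γ₂ ∪ C₂) u₂ v₂ m₂) + 1 = lam0 + S then
          T 1 (join (pat3 (γK ∪ CK) uK vK mK) (pat3 (γ₁ ∪ C₁) u₁ v₁ m₁) (pat3 (γ₂ ∪ C₂) u₂ v₂ m₂))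
            (join (pat3 (EK \ γK ∪ CK) uK vK mK) (pat3 (E₁ \ γ₁ ∪ C₁) u₁ v₁ m₁) (pat3 (E₂ \ γ₂ ∪ C₂) u₂ v₂ m₂)) else 0)) : ℤ) : ℝ) := by
    rw [key]
    push_cast
    refine Finset.sum_congr rfl fun γK _ => ?_
    rw [← Finset.sum_add_distrib]
    refine Finset.sum_congr rfl fun γ₁ _ => ?_
    rw [← Finset.sum_add_distrib]
    refine Finset.sum_congr rfl fun γ₂ _ => ?_
    set N := apExpC EK CK γK + apExpC E₁ C₁ γ₁ + apExpC E₂ C₂ γ₂ + corr (pat3 (γK ∪ CK) uK vK mK) (pat3 (γ₁ ∪ C₁) u₁ v₁ m₁) (pat3 (γ₂ ∪ C₂) u₂ v₂ m₂) +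
      corr (pat3 (EK \ γK ∪ CK) uK vK mK) (pat3 (E₁ \ γ₁ ∪ C₁) u₁ v₁ m₁) (pat3 (E₂ \ γ₂ ∪ C₂) u₂ v₂ m₂) with hN
    by_cases a0 : N = lam0 + S <;> by_cases a1 : N + 1 = lam0 + S
    · exfalso; omega
    · simp [a0]
    · simp [a0, a1]
    · simp [a0, a1]
  exact_mod_cast this

/-- Flipping one piece inside a configuration sum: the level is kept, the two patterns are exchanged. [folklore] -/
theorem sum_powerset_flip3C (E C : Finset (Sym2 V)) (x y s : V) (F : ℕ → Pat3 → Pat3 → ℤ) :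
    ∑ γ ∈ E.powerset, F (apExpC E C γ) (pat3 (γ ∪ C) x y s) (pat3 (E \ γ ∪ C) x y s) =
      ∑ γ ∈ E.powerset, F (apExpC E C γ) (pat3 (E \ γ ∪ C) x y s) (pat3 (γ ∪ C) x y s) := by
  rw [sum_powerset_flip E (fun γ => F (apExpC E C γ) (pat3 (E \ γ ∪ C) x y s) (pat3 (γ ∪ C) x y s))]
  refine Finset.sum_congr rfl fun γ hγ => ?_
  have h := Finset.mem_powerset.1 hγ
  rw [apExpC_compl h, Finset.sdiff_sdiff_eq_self h]

/-- The sum over configuration triples of the three pieces of a term depending on the levels and the pattern pairs. [folklore] -/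
def tripleSumC (EK CK E₁ C₁ E₂ C₂ : Finset (Sym2 V)) (uK vK mK u₁ v₁ m₁ u₂ v₂ m₂ : V)
    (X : ℕ → ℕ → ℕ → Pat3 → Pat3 → Pat3 → Pat3 → Pat3 → Pat3 → ℤ) : ℤ :=
  ∑ γK ∈ EK.powerset, ∑ γ₁ ∈ E₁.powerset, ∑ γ₂ ∈ E₂.powerset,
    X (apExpC EK CK γK) (apExpC E₁ C₁ γ₁) (apExpC E₂ C₂ γ₂) (pat3 (γK ∪ CK) uK vK mK) (pat3 (EK \ γK ∪ CK) uK vK mK)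
      (pat3 (γ₁ ∪ C₁) u₁ v₁ m₁) (pat3 (E₁ \ γ₁ ∪ C₁) u₁ v₁ m₁) (pat3 (γ₂ ∪ C₂) u₂ v₂ m₂) (pat3 (E₂ \ γ₂ ∪ C₂) u₂ v₂ m₂)

variable (EK CK E₁ C₁ E₂ C₂ : Finset (Sym2 V)) (uK vK mK u₁ v₁ m₁ u₂ v₂ m₂ : V)

/-- Flip of the first piece inside a triple sum. [folklore] -/
theorem tripleSumC_flipK (X : ℕ → ℕ → ℕ → Pat3 → Pat3 → Pat3 → Pat3 → Pat3 → Pat3 → ℤ) :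
    tripleSumC EK CK E₁ C₁ E₂ C₂ uK vK mK u₁ v₁ m₁ u₂ v₂ m₂ X =
      tripleSumC EK CK E₁ C₁ E₂ C₂ uK vK mK u₁ v₁ m₁ u₂ v₂ m₂ (fun eK e1 e2 PK QK P1 Q1 P2 Q2 => X eK e1 e2 QK PK P1 Q1 P2 Q2) := by
  unfold tripleSumC
  exact sum_powerset_flip3C EK CK uK vK mK (fun eK PK QK => ∑ γ₁ ∈ E₁.powerset, ∑ γ₂ ∈ E₂.powerset,
    X eK (apExpC E₁ C₁ γ₁) (apExpC E₂ C₂ γ₂) PK QK (pat3 (γ₁ ∪ C₁) u₁ v₁ m₁) (pat3 (E₁ \ γ₁ ∪ C₁) u₁ v₁ m₁) (pat3 (γ₂ ∪ C₂) u₂ v₂ m₂)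
      (pat3 (E₂ \ γ₂ ∪ C₂) u₂ v₂ m₂))

/-- Flip of the second piece inside a triple sum. [folklore] -/
theorem tripleSumC_flip1 (X : ℕ → ℕ → ℕ → Pat3 → Pat3 → Pat3 → Pat3 → Pat3 → Pat3 → ℤ) :
    tripleSumC EK CK E₁ C₁ E₂ C₂ uK vK mK u₁ v₁ m₁ u₂ v₂ m₂ X =
      tripleSumC EK CK E₁ C₁ E₂ C₂ uK vK mK u₁ v₁ m₁ u₂ v₂ m₂ (fun eK e1 e2 PK QK P1 Q1 P2 Q2 => X eK e1 e2 PK QK Q1 P1 P2 Q2) := by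
  unfold tripleSumC
  refine Finset.sum_congr rfl fun γK _ => ?_
  exact sum_powerset_flip3C E₁ C₁ u₁ v₁ m₁ (fun e1 P1 Q1 => ∑ γ₂ ∈ E₂.powerset,
    X (apExpC EK CK γK) e1 (apExpC E₂ C₂ γ₂) (pat3 (γK ∪ CK) uK vK mK) (pat3 (EK \ γK ∪ CK) uK vK mK) P1 Q1 (pat3 (γ₂ ∪ C₂) u₂ v₂ m₂)
      (pat3 (E₂ \ γ₂ ∪ C₂) u₂ v₂ m₂))

/-- Flip of the third piece inside a triple sum. [folklore] -/
theorem tripleSumC_flip2 (X : ℕ → ℕ → ℕ → Pat3 → Pat3 → Pat3 → Pat3 → Pat3 → Pat3 → ℤ) :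
    tripleSumC EK CK E₁ C₁ E₂ C₂ uK vK mK u₁ v₁ m₁ u₂ v₂ m₂ X =
      tripleSumC EK CK E₁ C₁ E₂ C₂ uK vK mK u₁ v₁ m₁ u₂ v₂ m₂ (fun eK e1 e2 PK QK P1 Q1 P2 Q2 => X eK e1 e2 PK QK P1 Q1 Q2 P2) := by
  unfold tripleSumC
  refine Finset.sum_congr rfl fun γK _ => Finset.sum_congr rfl fun γ₁ _ => ?_
  exact sum_powerset_flip3C E₂ C₂ u₂ v₂ m₂ (fun e2 P2 Q2 =>
    X (apExpC EK CK γK) (apExpC E₁ C₁ γ₁) e2 (pat3 (γK ∪ CK) uK vK mK) (pat3 (EK \ γK ∪ CK) uK vK mK) (pat3 (γ₁ ∪ C₁) u₁ v₁ m₁)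
      (pat3 (E₁ \ γ₁ ∪ C₁) u₁ v₁ m₁) P2 Q2)

/-- Additivity of the triple sum. [folklore] -/
theorem tripleSumC_add (X X' : ℕ → ℕ → ℕ → Pat3 → Pat3 → Pat3 → Pat3 → Pat3 → Pat3 → ℤ) :
    tripleSumC EK CK E₁ C₁ E₂ C₂ uK vK mK u₁ v₁ m₁ u₂ v₂ m₂
        (fun eK e1 e2 PK QK P1 Q1 P2 Q2 => X eK e1 e2 PK QK P1 Q1 P2 Q2 + X' eK e1 e2 PK QK P1 Q1 P2 Q2) =
      tripleSumC EK CK E₁ C₁ E₂ C₂ uK vK mK u₁ v₁ m₁ u₂ v₂ m₂ X + tripleSumC EK CK E₁ C₁ E₂ C₂ uK vK mK u₁ v₁ m₁ u₂ v₂ m₂ X' := by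
  unfold tripleSumC
  simp only [Finset.sum_add_distrib]

/-- Homogeneity of the triple sum. [folklore] -/
theorem tripleSumC_const_mul (c : ℤ) (X : ℕ → ℕ → ℕ → Pat3 → Pat3 → Pat3 → Pat3 → Pat3 → Pat3 → ℤ) :
    tripleSumC EK CK E₁ C₁ E₂ C₂ uK vK mK u₁ v₁ m₁ u₂ v₂ m₂ (fun eK e1 e2 PK QK P1 Q1 P2 Q2 => c * X eK e1 e2 PK QK P1 Q1 P2 Q2) =
      c * tripleSumC EK CK E₁ C₁ E₂ C₂ uK vK mK u₁ v₁ m₁ u₂ v₂ m₂ X := by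
  unfold tripleSumC
  simp only [Finset.mul_sum]

/-- The triple sum commutes with finite sums of terms. [folklore] -/
theorem tripleSumC_finset_sum {ι : Type*} (J : Finset ι) (X : ι → ℕ → ℕ → ℕ → Pat3 → Pat3 → Pat3 → Pat3 → Pat3 → Pat3 → ℤ) :
    tripleSumC EK CK E₁ C₁ E₂ C₂ uK vK mK u₁ v₁ m₁ u₂ v₂ m₂ (fun eK e1 e2 PK QK P1 Q1 P2 Q2 => ∑ j ∈ J, X j eK e1 e2 PK QK P1 Q1 P2 Q2) =
      ∑ j ∈ J, tripleSumC EK CK E₁ C₁ E₂ C₂ uK vK mK u₁ v₁ m₁ u₂ v₂ m₂ (X j) := by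
  unfold tripleSumC
  symm
  rw [Finset.sum_comm]
  refine Finset.sum_congr rfl fun γK _ => ?_
  rw [Finset.sum_comm]
  refine Finset.sum_congr rfl fun γ₁ _ => ?_
  rw [Finset.sum_comm]

/-- Monotonicity of the triple sum. [folklore] -/
theorem tripleSumC_mono {X X' : ℕ → ℕ → ℕ → Pat3 → Pat3 → Pat3 → Pat3 → Pat3 → Pat3 → ℤ}
    (h : ∀ eK e1 e2 PK QK P1 Q1 P2 Q2, X eK e1 e2 PK QK P1 Q1 P2 Q2 ≤ X' eK e1 e2 PK QK P1 Q1 P2 Q2) :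
    tripleSumC EK CK E₁ C₁ E₂ C₂ uK vK mK u₁ v₁ m₁ u₂ v₂ m₂ X ≤ tripleSumC EK CK E₁ C₁ E₂ C₂ uK vK mK u₁ v₁ m₁ u₂ v₂ m₂ X' := by
  unfold tripleSumC
  exact Finset.sum_le_sum fun _ _ => Finset.sum_le_sum fun _ _ => Finset.sum_le_sum fun _ _ => h ..

/-- A term with nonnegative values has a nonnegative triple sum. [folklore] -/
theorem tripleSumC_nonneg {X : ℕ → ℕ → ℕ → Pat3 → Pat3 → Pat3 → Pat3 → Pat3 → Pat3 → ℤ}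
    (h : ∀ eK e1 e2 PK QK P1 Q1 P2 Q2, 0 ≤ X eK e1 e2 PK QK P1 Q1 P2 Q2) :
    0 ≤ tripleSumC EK CK E₁ C₁ E₂ C₂ uK vK mK u₁ v₁ m₁ u₂ v₂ m₂ X := by
  unfold tripleSumC
  exact Finset.sum_nonneg fun _ _ => Finset.sum_nonneg fun _ _ => Finset.sum_nonneg fun _ _ => h ..

/-- **Eight copies of a triple sum are the triple sum of the symmetrised term.** [folklore] -/
theorem tripleSumC_symm8 (X : ℕ → ℕ → ℕ → Pat3 → Pat3 → Pat3 → Pat3 → Pat3 → Pat3 → ℤ) :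
    8 * tripleSumC EK CK E₁ C₁ E₂ C₂ uK vK mK u₁ v₁ m₁ u₂ v₂ m₂ X = tripleSumC EK CK E₁ C₁ E₂ C₂ uK vK mK u₁ v₁ m₁ u₂ v₂ m₂ (symm8 X) := by
  -- first piece
  set Y1 : ℕ → ℕ → ℕ → Pat3 → Pat3 → Pat3 → Pat3 → Pat3 → Pat3 → ℤ :=
    fun eK e1 e2 PK QK P1 Q1 P2 Q2 => X eK e1 e2 PK QK P1 Q1 P2 Q2 + X eK e1 e2 QK PK P1 Q1 P2 Q2 with hY1
  have h1 : tripleSumC EK CK E₁ C₁ E₂ C₂ uK vK mK u₁ v₁ m₁ u₂ v₂ m₂ Y1 = 2 * tripleSumC EK CK E₁ C₁ E₂ C₂ uK vK mK u₁ v₁ m₁ u₂ v₂ m₂ X := by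
    rw [hY1, tripleSumC_add, ← tripleSumC_flipK]; ring
  -- second piece
  set Y2 : ℕ → ℕ → ℕ → Pat3 → Pat3 → Pat3 → Pat3 → Pat3 → Pat3 → ℤ :=
    fun eK e1 e2 PK QK P1 Q1 P2 Q2 => Y1 eK e1 e2 PK QK P1 Q1 P2 Q2 + Y1 eK e1 e2 PK QK Q1 P1 P2 Q2 with hY2
  have h2 : tripleSumC EK CK E₁ C₁ E₂ C₂ uK vK mK u₁ v₁ m₁ u₂ v₂ m₂ Y2 = 2 * tripleSumC EK CK E₁ C₁ E₂ C₂ uK vK mK u₁ v₁ m₁ u₂ v₂ m₂ Y1 := by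
    rw [hY2, tripleSumC_add, ← tripleSumC_flip1]; ring
  -- third piece
  set Y3 : ℕ → ℕ → ℕ → Pat3 → Pat3 → Pat3 → Pat3 → Pat3 → Pat3 → ℤ :=
    fun eK e1 e2 PK QK P1 Q1 P2 Q2 => Y2 eK e1 e2 PK QK P1 Q1 P2 Q2 + Y2 eK e1 e2 PK QK P1 Q1 Q2 P2 with hY3
  have h3 : tripleSumC EK CK E₁ C₁ E₂ C₂ uK vK mK u₁ v₁ m₁ u₂ v₂ m₂ Y3 = 2 * tripleSumC EK CK E₁ C₁ E₂ C₂ uK vK mK u₁ v₁ m₁ u₂ v₂ m₂ Y2 := by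
    rw [hY3, tripleSumC_add, ← tripleSumC_flip2]; ring
  have hY : Y3 = symm8 X := by
    funext eK e1 e2 PK QK P1 Q1 P2 Q2
    simp only [hY3, hY2, hY1, symm8]
  rw [← hY, h3, h2, h1]; ring

/-- **The product side is nonnegative**: the triple sum of a product's term regroups, piece by piece (`FK.regroup1C`), into
`Σ_{μ_K+μ_1+μ_2+κ = N} Π_p lev2 (piece_p) g_p μ_p ≥ 0`. [folklore] -/
theorem tripleSumC_bterm_nonneg (p : Prod3) (N : ℕ)
    (hp : ∀ μ : ℕ, 0 ≤ lev2C EK CK uK vK mK p.gK μ ∧ 0 ≤ lev2C E₁ C₁ u₁ v₁ m₁ p.g1 μ ∧ 0 ≤ lev2C E₂ C₂ u₂ v₂ m₂ p.g2 μ) :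
    0 ≤ tripleSumC EK CK E₁ C₁ E₂ C₂ uK vK mK u₁ v₁ m₁ u₂ v₂ m₂ (bterm p N) := by
  unfold tripleSumC bterm
  -- piece 2
  have E01 : ∑ γK ∈ EK.powerset, ∑ γ₁ ∈ E₁.powerset, ∑ γ₂ ∈ E₂.powerset,
        ∑ cK ∈ Finset.range 2, ∑ c1 ∈ Finset.range 2, ∑ c2 ∈ Finset.range 2,
          (if apExpC EK CK γK + apExpC E₁ C₁ γ₁ + apExpC E₂ C₂ γ₂ + (cK + c1 + c2 + p.shift) = N then
            p.gK cK (pat3 (γK ∪ CK) uK vK mK) (pat3 (EK \ γK ∪ CK) uK vK mK) * p.g1 c1 (pat3 (γ₁ ∪ C₁) u₁ v₁ m₁) (pat3 (E₁ \ γ₁ ∪ C₁) u₁ v₁ m₁) *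
              p.g2 c2 (pat3 (γ₂ ∪ C₂) u₂ v₂ m₂) (pat3 (E₂ \ γ₂ ∪ C₂) u₂ v₂ m₂) else 0) =
        ∑ γK ∈ EK.powerset, ∑ γ₁ ∈ E₁.powerset, ∑ cK ∈ Finset.range 2, ∑ c1 ∈ Finset.range 2,
          ∑ μ2 ∈ Finset.range (N + 1), (if μ2 + (apExpC EK CK γK + cK + apExpC E₁ C₁ γ₁ + c1 + p.shift) = N then
            lev2C E₂ C₂ u₂ v₂ m₂ p.g2 μ2 * (p.gK cK (pat3 (γK ∪ CK) uK vK mK) (pat3 (EK \ γK ∪ CK) uK vK mK) *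
              p.g1 c1 (pat3 (γ₁ ∪ C₁) u₁ v₁ m₁) (pat3 (E₁ \ γ₁ ∪ C₁) u₁ v₁ m₁)) else 0) := by
    refine Finset.sum_congr rfl fun γK _ => Finset.sum_congr rfl fun γ₁ _ => ?_
    rw [Finset.sum_comm]
    refine Finset.sum_congr rfl fun cK _ => ?_
    rw [Finset.sum_comm]
    refine Finset.sum_congr rfl fun c1 _ => ?_
    rw [← regroup1C E₂ C₂ u₂ v₂ m₂ p.g2 N (apExpC EK CK γK + cK + apExpC E₁ C₁ γ₁ + c1 + p.shift)]
    refine Finset.sum_congr rfl fun γ₂ _ => Finset.sum_congr rfl fun c2 _ => ?_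
    exact ite_eq_ite_of_iff (by constructor <;> intro h <;> omega) (by ring)
  -- piece 1
  have E12 : ∑ γK ∈ EK.powerset, ∑ γ₁ ∈ E₁.powerset, ∑ cK ∈ Finset.range 2, ∑ c1 ∈ Finset.range 2,
        ∑ μ2 ∈ Finset.range (N + 1), (if μ2 + (apExpC EK CK γK + cK + apExpC E₁ C₁ γ₁ + c1 + p.shift) = N then
          lev2C E₂ C₂ u₂ v₂ m₂ p.g2 μ2 * (p.gK cK (pat3 (γK ∪ CK) uK vK mK) (pat3 (EK \ γK ∪ CK) uK vK mK) *
            p.g1 c1 (pat3 (γ₁ ∪ C₁) u₁ v₁ m₁) (pat3 (E₁ \ γ₁ ∪ C₁) u₁ v₁ m₁)) else 0) =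
      ∑ γK ∈ EK.powerset, ∑ cK ∈ Finset.range 2, ∑ μ2 ∈ Finset.range (N + 1), ∑ μ1 ∈ Finset.range (N + 1),
        (if μ1 + (apExpC EK CK γK + cK + μ2 + p.shift) = N then
          lev2C E₁ C₁ u₁ v₁ m₁ p.g1 μ1 * (lev2C E₂ C₂ u₂ v₂ m₂ p.g2 μ2 * p.gK cK (pat3 (γK ∪ CK) uK vK mK) (pat3 (EK \ γK ∪ CK) uK vK mK))
          else 0) := by
    refine Finset.sum_congr rfl fun γK _ => ?_
    rw [Finset.sum_comm]
    refine Finset.sum_congr rfl fun cK _ => ?_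
    rw [Finset.sum_congr rfl fun γ₁ _ => Finset.sum_comm, Finset.sum_comm]
    refine Finset.sum_congr rfl fun μ2 _ => ?_
    rw [← regroup1C E₁ C₁ u₁ v₁ m₁ p.g1 N (apExpC EK CK γK + cK + μ2 + p.shift)]
    refine Finset.sum_congr rfl fun γ₁ _ => Finset.sum_congr rfl fun c1 _ => ?_
    exact ite_eq_ite_of_iff (by constructor <;> intro h <;> omega) (by ring)
  -- piece K
  have E23 : ∑ γK ∈ EK.powerset, ∑ cK ∈ Finset.range 2, ∑ μ2 ∈ Finset.range (N + 1), ∑ μ1 ∈ Finset.range (N + 1),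
        (if μ1 + (apExpC EK CK γK + cK + μ2 + p.shift) = N then
          lev2C E₁ C₁ u₁ v₁ m₁ p.g1 μ1 * (lev2C E₂ C₂ u₂ v₂ m₂ p.g2 μ2 * p.gK cK (pat3 (γK ∪ CK) uK vK mK) (pat3 (EK \ γK ∪ CK) uK vK mK))
          else 0) =
      ∑ μ2 ∈ Finset.range (N + 1), ∑ μ1 ∈ Finset.range (N + 1), ∑ μK ∈ Finset.range (N + 1),
        (if μK + (μ1 + μ2 + p.shift) = N then
          lev2C EK CK uK vK mK p.gK μK * (lev2C E₁ C₁ u₁ v₁ m₁ p.g1 μ1 * lev2C E₂ C₂ u₂ v₂ m₂ p.g2 μ2) else 0) := by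
    rw [Finset.sum_congr rfl fun γK _ => Finset.sum_comm]
    rw [Finset.sum_congr rfl fun γK _ => Finset.sum_congr rfl fun μ2 _ => Finset.sum_comm]
    rw [Finset.sum_comm]
    refine Finset.sum_congr rfl fun μ2 _ => ?_
    rw [Finset.sum_comm]
    refine Finset.sum_congr rfl fun μ1 _ => ?_
    rw [← regroup1C EK CK uK vK mK p.gK N (μ1 + μ2 + p.shift)]
    refine Finset.sum_congr rfl fun γK _ => Finset.sum_congr rfl fun cK _ => ?_
    exact ite_eq_ite_of_iff (by constructor <;> intro h <;> omega) (by ring)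
  rw [E01, E12, E23]
  refine Finset.sum_nonneg fun μ2 _ => Finset.sum_nonneg fun μ1 _ => Finset.sum_nonneg fun μK _ => ?_
  split_ifs
  · exact mul_nonneg (hp μK).1 (mul_nonneg (hp μ1).2.1 (hp μ2).2.2)
  · exact le_rfl

variable {EK CK E₁ C₁ E₂ C₂ uK vK mK u₁ v₁ m₁ u₂ v₂ m₂}

/-- **SYMMETRISED PRODUCT-CONE LEMMA FOR A THREE-PIECE GLUING (census g34 PROOF-THEOREM-SP §2.2 in the form its certificates
actually have; kernel).**  As `FK.cone3C_level_nonneg`, but the certificate need only dominate the target after summing over the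
flip orbit of each cell: `8 · Σ_j λ_j π_j(d; cell) ≤ D · Σ_{g ∈ (ℤ/2)³} τ_T(d; g·cell)` (`FK.target3Sym`).  Proof: the trilinear
decomposition is re-indexed by `γ_p ↦ E_p ∖ γ_p` on each piece (levels kept by `FK.apExp_compl`, patterns exchanged), the eight
copies are added (`FK.tripleSumC_symm8`), and the flip-invariant product side is bounded below by zero as before.
[cite: AyyerLinussonRavichandran2025, §7 (p. 22)] -/
theorem cone3C_level_nonneg_sym {G CG : Finset (Sym2 V)} {b s t : V}
    (join : Pat3 → Pat3 → Pat3 → Pat3) (corr : Pat3 → Pat3 → Pat3 → ℕ) (S : ℕ)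
    (hdec : ∀ (w : ℕ → ℝ) (tab : Pat3 → Pat3 → ℤ),
      tvalC (fun n => w (n + S)) G CG b s t tab =
        ∑ γK ∈ EK.powerset, ∑ γ₁ ∈ E₁.powerset, ∑ γ₂ ∈ E₂.powerset,
          w (apExpC EK CK γK + apExpC E₁ C₁ γ₁ + apExpC E₂ C₂ γ₂ +
                corr (pat3 (γK ∪ CK) uK vK mK) (pat3 (γ₁ ∪ C₁) u₁ v₁ m₁) (pat3 (γ₂ ∪ C₂) u₂ v₂ m₂) +
              corr (pat3 (EK \ γK ∪ CK) uK vK mK) (pat3 (E₁ \ γ₁ ∪ C₁) u₁ v₁ m₁) (pat3 (E₂ \ γ₂ ∪ C₂) u₂ v₂ m₂)) *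
            (tab (join (pat3 (γK ∪ CK) uK vK mK) (pat3 (γ₁ ∪ C₁) u₁ v₁ m₁) (pat3 (γ₂ ∪ C₂) u₂ v₂ m₂))
              (join (pat3 (EK \ γK ∪ CK) uK vK mK) (pat3 (E₁ \ γ₁ ∪ C₁) u₁ v₁ m₁) (pat3 (E₂ \ γ₂ ∪ C₂) u₂ v₂ m₂)) : ℝ))
    (T : ℕ → Pat3 → Pat3 → ℤ) (D : ℕ) {ι : Type*} (J : Finset ι) (prod : ι → Prod3)
    (hcert : ∀ d : ℕ, ∀ PK QK P1 Q1 P2 Q2 : Pat3,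
      8 * ∑ j ∈ J, ((prod j).lam : ℤ) * (prod j).tensor d PK QK P1 Q1 P2 Q2 ≤
        D * target3Sym join corr T d PK QK P1 Q1 P2 Q2)
    (hval : ∀ j ∈ J, ∀ μ : ℕ,
      0 ≤ lev2C EK CK uK vK mK (prod j).gK μ ∧ 0 ≤ lev2C E₁ C₁ u₁ v₁ m₁ (prod j).g1 μ ∧ 0 ≤ lev2C E₂ C₂ u₂ v₂ m₂ (prod j).g2 μ)
    (lam0 : ℕ) : 0 ≤ (D : ℤ) * lev2C G CG b s t T lam0 := by
  set N := lam0 + S with hN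
  -- Step 1: the decomposition, as a triple sum of the target-side term, symmetrised
  have e1 : lev2C G CG b s t T lam0 = tripleSumC EK CK E₁ C₁ E₂ C₂ uK vK mK u₁ v₁ m₁ u₂ v₂ m₂ (xterm join corr T N) := by
    rw [lev2C_decomp3 join corr S hdec T lam0]
    rfl
  have e8 : 8 * ((D : ℤ) * lev2C G CG b s t T lam0) =
      (D : ℤ) * tripleSumC EK CK E₁ C₁ E₂ C₂ uK vK mK u₁ v₁ m₁ u₂ v₂ m₂ (symm8 (xterm join corr T N)) := by
    rw [e1, ← tripleSumC_symm8]; ring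
  -- Step 2: termwise domination by the certificate
  have step2 : ∀ eK e1 e2 PK QK P1 Q1 P2 Q2,
      8 * ∑ j ∈ J, ((prod j).lam : ℤ) * bterm (prod j) N eK e1 e2 PK QK P1 Q1 P2 Q2 ≤
        (D : ℤ) * symm8 (xterm join corr T N) eK e1 e2 PK QK P1 Q1 P2 Q2 := by
    intro eK e1 e2 PK QK P1 Q1 P2 Q2
    by_cases hle : eK + e1 + e2 ≤ N
    · obtain ⟨d, hd⟩ := Nat.exists_eq_add_of_le hle
      have hd' : eK + e1 + e2 + d = N := hd.symm
      have hx : symm8 (xterm join corr T N) eK e1 e2 PK QK P1 Q1 P2 Q2 = target3Sym join corr T d PK QK P1 Q1 P2 Q2 := by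
        simp only [symm8, target3Sym, xterm_eq_target3 join corr T hd']
      rw [hx, Finset.sum_congr rfl fun j _ => by rw [bterm_eq_tensor (prod j) hd']]
      exact hcert d PK QK P1 Q1 P2 Q2
    · rw [not_le] at hle
      have hx : symm8 (xterm join corr T N) eK e1 e2 PK QK P1 Q1 P2 Q2 = 0 := by
        simp only [symm8, xterm_eq_zero join corr T hle, add_zero]
      rw [hx, mul_zero, Finset.sum_eq_zero fun j _ => by rw [bterm_eq_zero (prod j) hle, mul_zero], mul_zero]
  -- Step 3: assemble
  have main : 0 ≤ 8 * ((D : ℤ) * lev2C G CG b s t T lam0) := by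
    rw [e8, ← tripleSumC_const_mul]
    refine le_trans ?_ (tripleSumC_mono EK CK E₁ C₁ E₂ C₂ uK vK mK u₁ v₁ m₁ u₂ v₂ m₂ step2)
    rw [tripleSumC_const_mul, tripleSumC_finset_sum]
    refine mul_nonneg (by norm_num) (Finset.sum_nonneg fun j hj => ?_)
    rw [tripleSumC_const_mul]
    exact mul_nonneg (Nat.cast_nonneg _) (tripleSumC_bterm_nonneg EK CK E₁ C₁ E₂ C₂ uK vK mK u₁ v₁ m₁ u₂ v₂ m₂ (prod j) N (hval j hj))
  linarith

end MinorCone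

end FK

end Summit.CriticalPhenomena.PercolationContinuityZ3.Theorems

end
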